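import Literature.MathematicalPhysics.QuantumManyBody.PeriodicBoseGasScatteringODEProofs
import Literature.MathematicalPhysics.QuantumManyBody.PeriodicBoseGasScattering
import HarnessLib

/-!
# The scattering profile of a bounded potential: regularity, flux identities, `a = lim (r - u/u')`

Topic `Literature/MathematicalPhysics/QuantumManyBody`, sibling of `PeriodicBoseGasScatteringODEProofs.lean`
(provefact `Literature.MathematicalPhysics.QuantumManyBody.BoseGas.Fournais2020_condensation`, layer
`LSSY2005_scatteringSolution` = [LSSY2005, App. C, Thm. C.1] / [Fournais2020, App. A]). For a *bounded*
measurable potential profile `w ≤ M` vanishing on `(R, ∞)` (`R > 0`, also the normalisation radius)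
this file completes the one-body theory of the normalised zero-energy profile `f = u/(u'(R) r)` of
`PeriodicBoseGasScatteringODE.lean` and identifies the two scattering lengths of the tree:

* `contDiff_radialProfile`: `f ∈ C¹(ℝ)` with `f'(0) = 0` (`f - f(0) = O(r²)` at the origin,
  `hasDerivAt_radialProfile_zero`), and `radialFun_contDiff_of_deriv_zero`: a radial function
  `g(|x|)` of a `C¹` profile with `g'(0) = 0` is `C¹` on `ℝ³` (so `φ₀ = f(|x|)` is `C¹`);
* `profile_flux_identity`: the radial equation in integrated form,
  `∫_0^T r² f' k' = T² f'(T) k(T) - ∫_0^T ½W s² f k` for `k ∈ C¹` (from `flux_integral_mul_deriv`),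
  whence the **energy identity** `∫_0^T r²(f'² + ½Wf²) = T² f'(T) f(T)` (`profile_energy_identity`)
  and the **ray lower bound** `∫_0^T r²(g'² + ½Wg²) ≥ T² f'(T) g(T)²/f(T)` for every `g ∈ C¹`
  (`profile_ray_lower_bound`: ground-state substitution `g = fh`, the defect being `∫ r²f²h'²`);
* `scatteringLength_eq_ofReal_odeScatteringLength`: **`4π a_ODE = inf 𝓔`**, i.e. the variational
  scattering length `scatteringLength w` of `PeriodicBoseGas.lean` [LSSY2005, (C.4)–(C.8)] equals
  `odeScatteringLength w R = R - u(R)/u'(R)` [LSSY2005, (2.5)]: `≥` by polar coordinates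
  (`lintegral_rayEnergy_le`) and the ray lower bound (every admissible `φ` is `1` far out on each
  ray, where `T²f'(T) = a`, `f(T) = 1 - a/T ≤ 1`); `≤` by the radial `C¹` trial functions
  `g_T = f + χ_T(1 - f)` (`trialProfile`, `χ_T` the smooth step across `[T, 2T]`), whose energy is
  `4π(a(1 - a/T) + O(a²/T))` by the energy identity and `|g_T'| ≤ (1 + M_χ)a/T²` on the layer;
* `lintegral_pot_mul_scatteringProfile`: **`∫ w(|x|) f(|x|) dx = 8πa`** [Fournais2020, (A.5)] (the
  total flux `∫_0^R ½W s² f = a`, `integral_pot_sq_profile`).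

The distributional scattering equation and the passage to unbounded integrable potentials are in
the sibling files.

## References

* [LSSY2005] E. H. Lieb, R. Seiringer, J. P. Solovej, J. Yngvason, *The Mathematics of the Bose
  Gas and its Condensation*, Birkhäuser 2005, arXiv:cond-mat/0610117: (2.4)–(2.5); App. C,
  Thm. C.1 (C.1)–(C.8), Lemma C.2.
* [Fournais2020] S. Fournais, *Length scales for BEC in the dilute Bose gas*, arXiv:2011.00309:
  App. A (A.1)–(A.5).
-/

noncomputable section

open MeasureTheory Set Filter Topology Metric
open scoped ENNReal NNReal

namespace Literature.MathematicalPhysics.QuantumManyBody.BoseGas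

/-! ### Regularity of the profile at the origin -/

section Origin

variable {w : ℝ → ℝ≥0∞} {M R : ℝ}

/-- `0 ≤ u(r) - r ≤ (M/2) r² u(r)` for `r ≥ 0` (the Volterra correction is quadratic at the origin).
[cite: LSSY2005, (2.4)] -/
theorem radialSol_sub_self_bounds (hw : Measurable w) (hM : ∀ r, w r ≤ ENNReal.ofReal M) (hM0 : 0 ≤ M)
    {r : ℝ} (hr : 0 ≤ r) :
    0 ≤ radialSol w r - r ∧ radialSol w r - r ≤ M / 2 * r ^ 2 * radialSol w r := by
  have hex : radialSol w r - r = ∫ s in Ioc 0 r, (r - s) * ((w s).toReal / 2) * radialSol w s := by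
    rw [radialSol_eq hw hM hM0 hr]; ring
  rw [hex]
  refine ⟨setIntegral_nonneg measurableSet_Ioc fun s hs => ?_, ?_⟩
  · have : 0 ≤ (w s).toReal / 2 := div_nonneg ENNReal.toReal_nonneg zero_le_two
    have := radialSol_nonneg w s
    have : 0 ≤ r - s := by linarith [hs.2]
    positivity
  calc ∫ s in Ioc 0 r, (r - s) * ((w s).toReal / 2) * radialSol w s
      ≤ ∫ _ in Ioc 0 r, r * (M / 2) * radialSol w r := by
        refine setIntegral_mono_on (integrableOn_volterraIntegrand hw hM hM0 hr)
          (integrableOn_const (by rw [Real.volume_Ioc]; exact ENNReal.ofReal_ne_top)) measurableSet_Ioc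
          fun s hs => ?_
        have h1 : (w s).toReal / 2 ≤ M / 2 := by linarith [toReal_pot_le hM hM0 s]
        have h2 : radialSol w s ≤ radialSol w r := radialSol_mono hw hM hM0 hs.1.le hs.2
        have : 0 ≤ (w s).toReal / 2 := div_nonneg ENNReal.toReal_nonneg zero_le_two
        have := radialSol_nonneg w s
        have : 0 ≤ r - s := by linarith [hs.2]
        gcongr
        linarith [hs.1]
    _ = M / 2 * r ^ 2 * radialSol w r := by
        rw [setIntegral_const, Real.volume_real_Ioc_of_le hr, sub_zero, smul_eq_mul]; ring

/-- **Quadratic contact at the origin**: `0 ≤ f(r) - f(0) ≤ (M e^{M/4}/(2u'(R))) r²` for `0 < r ≤ 1`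
(`f(0) = 1/u'(R)`). [cite: LSSY2005, Thm. C.1] -/
theorem radialProfile_sub_zero_bounds (hw : Measurable w) (hM : ∀ r, w r ≤ ENNReal.ofReal M) (hM0 : 0 ≤ M)
    {r : ℝ} (hr : 0 < r) (hr1 : r ≤ 1) :
    0 ≤ radialProfile w R r - radialProfile w R 0 ∧
      radialProfile w R r - radialProfile w R 0 ≤
        M / 2 * Real.exp (M / 4) / radialSolDeriv w R * r ^ 2 := by
  have hc := slope_pos hw hM hM0 R
  have hkey : radialProfile w R r - radialProfile w R 0 = (radialSol w r - r) / (radialSolDeriv w R * r) := by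
    rw [radialProfile_of_pos w R hr, radialProfile_of_nonpos w R le_rfl]; field_simp
  rw [hkey]
  have hb := radialSol_sub_self_bounds hw hM hM0 hr.le
  refine ⟨div_nonneg hb.1 (by positivity), ?_⟩
  rw [div_le_iff₀ (by positivity)]
  have hu : radialSol w r ≤ r * Real.exp (M / 4) := by
    calc radialSol w r ≤ r * Real.exp (M * r ^ 2 / 4) := radialSol_le_exp hw hM hM0 hr.le
      _ ≤ r * Real.exp (M / 4) := by
          gcongr
          have : r ^ 2 ≤ 1 := by nlinarith
          nlinarith
  calc radialSol w r - r ≤ M / 2 * r ^ 2 * radialSol w r := hb.2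
    _ ≤ M / 2 * r ^ 2 * (r * Real.exp (M / 4)) := by gcongr
    _ = M / 2 * Real.exp (M / 4) / radialSolDeriv w R * r ^ 2 * (radialSolDeriv w R * r) := by
        field_simp

/-- **`f'(0) = 0`**: the profile is differentiable at the origin with vanishing derivative (it is
constant on `(-∞, 0]` and `f(r) - f(0) = O(r²)` on the right). [cite: LSSY2005, Thm. C.1] -/
theorem hasDerivAt_radialProfile_zero (hw : Measurable w) (hM : ∀ r, w r ≤ ENNReal.ofReal M) (hM0 : 0 ≤ M) :
    HasDerivAt (radialProfile w R) 0 0 := by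
  set C : ℝ := M / 2 * Real.exp (M / 4) / radialSolDeriv w R with hC
  have hc := slope_pos hw hM hM0 R
  have hC0 : 0 ≤ C := by positivity
  rw [hasDerivAt_iff_isLittleO]
  simp only [sub_zero, smul_zero]
  -- `|f(r) - f(0)| ≤ C r²` near `0`
  have hbound : ∀ᶠ r in 𝓝 (0 : ℝ), ‖radialProfile w R r - radialProfile w R 0‖ ≤ C * ‖r ^ 2‖ := by
    filter_upwards [Icc_mem_nhds (show (-1 : ℝ) < 0 by norm_num) (show (0 : ℝ) < 1 by norm_num)] with r hr
    rw [Real.norm_eq_abs, Real.norm_eq_abs, abs_of_nonneg (sq_nonneg r)]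
    rcases le_or_gt r 0 with h0 | h0
    · rw [radialProfile_of_nonpos w R h0, radialProfile_of_nonpos w R le_rfl, sub_self, abs_zero]
      positivity
    · have hb := radialProfile_sub_zero_bounds (R := R) hw hM hM0 h0 hr.2
      rw [abs_of_nonneg hb.1]
      exact hb.2
  have h1 : (fun r => radialProfile w R r - radialProfile w R 0) =O[𝓝 (0 : ℝ)] fun r => r ^ 2 :=
    Asymptotics.IsBigO.of_bound C hbound
  have h2 : (fun r : ℝ => r ^ 2) =o[𝓝 (0 : ℝ)] fun r => r := by
    have := Asymptotics.isLittleO_pow_id (𝕜 := ℝ) (n := 2) one_lt_two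
    simpa using this
  exact h1.trans_isLittleO h2

/-- The profile is differentiable on `ℝ`. [cite: LSSY2005, Thm. C.1] -/
theorem hasDerivAt_radialProfile' (hw : Measurable w) (hM : ∀ r, w r ≤ ENNReal.ofReal M) (hM0 : 0 ≤ M)
    (r : ℝ) :
    HasDerivAt (radialProfile w R)
      (if 0 < r then (r * radialSolDeriv w r - radialSol w r) / (radialSolDeriv w R * r ^ 2) else 0) r := by
  rcases lt_trichotomy r 0 with hr | hr | hr
  · rw [if_neg (not_lt.mpr hr.le)]
    have hev : radialProfile w R =ᶠ[𝓝 r] fun _ => (radialSolDeriv w R)⁻¹ := by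
      filter_upwards [Iio_mem_nhds hr] with s hs
      exact radialProfile_of_nonpos w R (le_of_lt hs)
    exact (hasDerivAt_const r _).congr_of_eventuallyEq hev
  · subst hr
    rw [if_neg (lt_irrefl _)]
    exact hasDerivAt_radialProfile_zero hw hM hM0
  · rw [if_pos hr]
    exact hasDerivAt_radialProfile hw hM hM0 R hr

/-- The derivative of the profile: `f'(r) = (r u'(r) - u(r))/(u'(R) r²)` for `r > 0`, `0` for `r ≤ 0`.
[cite: LSSY2005, Thm. C.1] -/
theorem deriv_radialProfile (hw : Measurable w) (hM : ∀ r, w r ≤ ENNReal.ofReal M) (hM0 : 0 ≤ M) (r : ℝ) :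
    deriv (radialProfile w R) r =
      if 0 < r then (r * radialSolDeriv w r - radialSol w r) / (radialSolDeriv w R * r ^ 2) else 0 :=
  (hasDerivAt_radialProfile' hw hM hM0 r).deriv

/-- `0 ≤ f'(r) ≤ (M/(2u'(R))) |r| e^{Mr²/4}` — the derivative vanishes continuously at the origin.
[cite: LSSY2005, Thm. C.1] -/
theorem deriv_radialProfile_bounds (hw : Measurable w) (hM : ∀ r, w r ≤ ENNReal.ofReal M) (hM0 : 0 ≤ M)
    (r : ℝ) :
    0 ≤ deriv (radialProfile w R) r ∧
      deriv (radialProfile w R) r ≤ M / 2 / radialSolDeriv w R * (|r| * Real.exp (M * r ^ 2 / 4)) := by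
  have hc := slope_pos hw hM hM0 R
  rw [deriv_radialProfile hw hM hM0]
  split_ifs with hr
  · have hb := mul_deriv_sub_sol_bounds hw hM hM0 hr.le
    refine ⟨div_nonneg hb.1 (by positivity), ?_⟩
    rw [div_le_iff₀ (by positivity), abs_of_pos hr]
    calc r * radialSolDeriv w r - radialSol w r ≤ M / 2 * r ^ 2 * radialSol w r := hb.2
      _ ≤ M / 2 * r ^ 2 * (r * Real.exp (M * r ^ 2 / 4)) := by
          gcongr; exact radialSol_le_exp hw hM hM0 hr.le
      _ = M / 2 / radialSolDeriv w R * (r * Real.exp (M * r ^ 2 / 4)) * (radialSolDeriv w R * r ^ 2) := by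
          field_simp
  · exact ⟨le_rfl, by positivity⟩

/-- The derivative of the profile is continuous on `ℝ`. [cite: LSSY2005, Thm. C.1] -/
theorem continuous_deriv_radialProfile (hw : Measurable w) (hM : ∀ r, w r ≤ ENNReal.ofReal M) (hM0 : 0 ≤ M) :
    Continuous (deriv (radialProfile w R)) := by
  have hc := slope_pos hw hM hM0 R
  rw [continuous_iff_continuousAt]
  intro r
  rcases lt_trichotomy r 0 with hr | hr | hr
  · -- locally zero
    have hev : deriv (radialProfile w R) =ᶠ[𝓝 r] fun _ => 0 := by
      filter_upwards [Iio_mem_nhds hr] with s hs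
      rw [deriv_radialProfile hw hM hM0, if_neg (not_lt.mpr (le_of_lt hs))]
    exact (continuousAt_const.congr hev.symm)
  · -- squeeze at the origin
    subst hr
    have h0 : deriv (radialProfile w R) 0 = 0 := by
      rw [deriv_radialProfile hw hM hM0, if_neg (lt_irrefl _)]
    rw [ContinuousAt, h0]
    refine squeeze_zero (fun s => (deriv_radialProfile_bounds hw hM hM0 s).1)
      (fun s => (deriv_radialProfile_bounds hw hM hM0 s).2) ?_
    have hcont : Continuous fun s : ℝ => M / 2 / radialSolDeriv w R * (|s| * Real.exp (M * s ^ 2 / 4)) := by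
      fun_prop
    have := hcont.tendsto 0
    simpa using this
  · -- the explicit formula on `(0, ∞)`
    have hev : deriv (radialProfile w R) =ᶠ[𝓝 r]
        fun s => (s * radialSolDeriv w s - radialSol w s) / (radialSolDeriv w R * s ^ 2) := by
      filter_upwards [Ioi_mem_nhds hr] with s hs
      rw [deriv_radialProfile hw hM hM0, if_pos (mem_Ioi.mp hs)]
    refine ContinuousAt.congr ?_ hev.symm
    have h1 : ContinuousAt (fun s => s * radialSolDeriv w s - radialSol w s) r :=
      ((continuousAt_id.mul (continuous_radialSolDeriv hw hM hM0).continuousAt).sub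
        (continuousAt_radialSol hw hM hM0 hr))
    have h2 : ContinuousAt (fun s => radialSolDeriv w R * s ^ 2) r := by fun_prop
    exact h1.div h2 (by positivity)

/-- **The profile is `C¹` on `ℝ`.** [cite: LSSY2005, Thm. C.1] -/
theorem contDiff_radialProfile (hw : Measurable w) (hM : ∀ r, w r ≤ ENNReal.ofReal M) (hM0 : 0 ≤ M) :
    ContDiff ℝ 1 (radialProfile w R) :=
  contDiff_one_iff_deriv.mpr ⟨fun r => (hasDerivAt_radialProfile' hw hM hM0 r).differentiableAt,
    continuous_deriv_radialProfile hw hM hM0⟩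

/-- `f'(0) = 0`. [cite: LSSY2005, Thm. C.1] -/
theorem deriv_radialProfile_zero (hw : Measurable w) (hM : ∀ r, w r ≤ ENNReal.ofReal M) (hM0 : 0 ≤ M) :
    deriv (radialProfile w R) 0 = 0 := by
  rw [deriv_radialProfile hw hM hM0, if_neg (lt_irrefl _)]

end Origin


/-! ### Radial functions with vanishing derivative at the origin -/

section RadialC1

open RealInnerProductSpace

variable {g : ℝ → ℝ}

/-- `‖g'(|x|)|x|⁻¹ ⟨x, ·⟩‖ ≤ |g'(|x|)|`. [folklore] -/
theorem norm_radialFDeriv_le (g : ℝ → ℝ) (x : Space) :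
    ‖(deriv g ‖x‖ * (‖x‖)⁻¹) • (innerSL ℝ x : Space →L[ℝ] ℝ)‖ ≤ |deriv g ‖x‖| := by
  rw [norm_smul, innerSL_apply_norm, Real.norm_eq_abs, abs_mul, abs_inv, abs_norm]
  rcases eq_or_ne x 0 with hx | hx
  · simp [hx]
  · rw [mul_assoc, inv_mul_cancel₀ (norm_ne_zero_iff.mpr hx), mul_one]

/-- At the origin a radial function with `g'(0) = 0` has zero derivative. [folklore] -/
theorem hasFDerivAt_radialFun_zero (hg : DifferentiableAt ℝ g 0) (h0 : deriv g 0 = 0) :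
    HasFDerivAt (radialFun g) (0 : Space →L[ℝ] ℝ) 0 := by
  have hd : HasDerivAt g 0 0 := by
    have := hg.hasDerivAt
    rwa [h0] at this
  rw [hasDerivAt_iff_isLittleO] at hd
  simp only [sub_zero, smul_zero] at hd
  rw [hasFDerivAt_iff_isLittleO_nhds_zero]
  simp only [zero_add, zero_apply, radialFun, norm_zero, sub_zero]
  have h1 : (fun x : Space => g ‖x‖ - g 0) =o[𝓝 (0 : Space)] fun x : Space => ‖x‖ := by
    have ht : Tendsto (fun x : Space => ‖x‖) (𝓝 0) (𝓝 0) := by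
      simpa using (continuous_norm (E := Space)).tendsto 0
    exact hd.comp_tendsto ht
  exact h1.trans_isBigO (Asymptotics.isBigO_norm_left.mpr (Asymptotics.isBigO_refl _ _))

/-- A radial function of a `C¹` profile with `g'(0) = 0` has derivative `g'(|x|)|x|⁻¹⟨x, ·⟩` everywhere.
[folklore] -/
theorem hasFDerivAt_radialFun' (hg : ContDiff ℝ 1 g) (h0 : deriv g 0 = 0) (x : Space) :
    HasFDerivAt (radialFun g) ((deriv g ‖x‖ * (‖x‖)⁻¹) • (innerSL ℝ x : Space →L[ℝ] ℝ)) x := by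
  rcases eq_or_ne x 0 with hx | hx
  · subst hx
    have : ((deriv g ‖(0 : Space)‖ * (‖(0 : Space)‖)⁻¹) • (innerSL ℝ (0 : Space) : Space →L[ℝ] ℝ)) = 0 := by simp
    rw [this]
    exact hasFDerivAt_radialFun_zero (hg.differentiable one_ne_zero 0) h0
  · exact hasFDerivAt_radialFun (hg.differentiable one_ne_zero) hx

/-- The derivative field is continuous. [folklore] -/
theorem continuous_radialFDeriv (hg : ContDiff ℝ 1 g) (h0 : deriv g 0 = 0) :
    Continuous fun x : Space => (deriv g ‖x‖ * (‖x‖)⁻¹) • (innerSL ℝ x : Space →L[ℝ] ℝ) := by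
  have hdc : Continuous (deriv g) := hg.continuous_deriv le_rfl
  rw [continuous_iff_continuousAt]
  intro x
  rcases eq_or_ne x 0 with hx | hx
  · subst hx
    have h00 : ((deriv g ‖(0 : Space)‖ * (‖(0 : Space)‖)⁻¹) • (innerSL ℝ (0 : Space) : Space →L[ℝ] ℝ)) = 0 := by simp
    rw [ContinuousAt, h00, tendsto_zero_iff_norm_tendsto_zero]
    refine squeeze_zero (fun y => norm_nonneg _) (fun y => norm_radialFDeriv_le g y) ?_
    have : Tendsto (fun y : Space => |deriv g ‖y‖|) (𝓝 0) (𝓝 (|deriv g ‖(0 : Space)‖|)) :=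
      ((continuous_abs.comp hdc).comp continuous_norm).tendsto 0
    simpa [h0] using this
  · have h1 : ContinuousAt (fun y : Space => deriv g ‖y‖ * (‖y‖)⁻¹) x :=
      (hdc.continuousAt.comp continuous_norm.continuousAt).mul
        ((continuous_norm.continuousAt).inv₀ (norm_ne_zero_iff.mpr hx))
    have h2 : Continuous fun y : Space => (innerSL ℝ y : Space →L[ℝ] ℝ) := (innerSL ℝ).continuous
    exact h1.smul h2.continuousAt

/-- **A radial function of a `C¹` profile with vanishing derivative at the origin is `C¹` on `ℝ³`.**
[folklore] -/
theorem radialFun_contDiff_of_deriv_zero (hg : ContDiff ℝ 1 g) (h0 : deriv g 0 = 0) :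
    ContDiff ℝ 1 (radialFun g) := by
  rw [contDiff_one_iff_hasFDerivAt]
  exact ⟨_, continuous_radialFDeriv hg h0, fun x => hasFDerivAt_radialFun' hg h0 x⟩

/-- `fderiv` of such a radial function. [folklore] -/
theorem fderiv_radialFun' (hg : ContDiff ℝ 1 g) (h0 : deriv g 0 = 0) (x : Space) :
    fderiv ℝ (radialFun g) x = (deriv g ‖x‖ * (‖x‖)⁻¹) • (innerSL ℝ x : Space →L[ℝ] ℝ) :=
  (hasFDerivAt_radialFun' hg h0 x).fderiv

end RadialC1


/-! ### The radial equation in flux form; energy identity and ray lower bound -/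

section Flux

variable {w : ℝ → ℝ≥0∞} {M R : ℝ}

/-- A continuous function times the (bounded) potential is integrable on `(0, T]`. [folklore] -/
theorem integrableOn_Ioc_pot_mul (hw : Measurable w) (hM : ∀ r, w r ≤ ENNReal.ofReal M) (hM0 : 0 ≤ M)
    {h : ℝ → ℝ} (hh : Continuous h) (T : ℝ) :
    IntegrableOn (fun s => (w s).toReal / 2 * h s) (Ioc 0 T) := by
  obtain ⟨C, hC⟩ := isCompact_Icc.exists_bound_of_continuousOn (s := Icc 0 T) hh.continuousOn
  refine integrableOn_Ioc_of_bound (C := M / 2 * C) ((hw.ennreal_toReal.div_const 2).mul hh.measurable)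
    fun s hs => ?_
  rw [abs_mul, abs_of_nonneg (div_nonneg ENNReal.toReal_nonneg zero_le_two)]
  have h1 : (w s).toReal / 2 ≤ M / 2 := by linarith [toReal_pot_le hM hM0 s]
  have h2 := hC s (Ioc_subset_Icc_self hs)
  rw [Real.norm_eq_abs] at h2
  have : 0 ≤ (w s).toReal / 2 := div_nonneg ENNReal.toReal_nonneg zero_le_two
  exact mul_le_mul h1 h2 (abs_nonneg _) (by positivity)

/-- **The radial equation in flux form, for the profile**: for `k ∈ C¹` and `T > 0`,
`∫_0^T r² f'(r) k'(r) dr = T² f'(T) k(T) - ∫_0^T ½ W(s) s² f(s) k(s) ds`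
(`r² f' u'(R) = r u' - u`, `u = u'(R) r f`, and `flux_integral_mul_deriv`). [cite: LSSY2005, App. C (C.2) and (2.4)–(2.5)] -/
theorem profile_flux_identity (hw : Measurable w) (hM : ∀ r, w r ≤ ENNReal.ofReal M) (hM0 : 0 ≤ M) (R : ℝ)
    {T : ℝ} (hT : 0 < T) {k : ℝ → ℝ} (hk : ContDiff ℝ 1 k) :
    ∫ r in Ioc 0 T, r ^ 2 * deriv (radialProfile w R) r * deriv k r =
      T ^ 2 * deriv (radialProfile w R) T * k T -
        ∫ s in Ioc 0 T, (w s).toReal / 2 * s ^ 2 * radialProfile w R s * k s := by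
  have hc : 0 < radialSolDeriv w R := slope_pos hw hM hM0 R
  have h := flux_integral_mul_deriv hw hM hM0 le_rfl hT.le
    (fun r _ => (hk.differentiable one_ne_zero r).hasDerivAt) (hk.continuous_deriv le_rfl).continuousOn
  -- the flux in terms of `f'`, the solution in terms of `f`
  have hm : ∀ r, 0 < r → r * radialSolDeriv w r - radialSol w r =
      radialSolDeriv w R * (r ^ 2 * deriv (radialProfile w R) r) := by
    intro r hr
    rw [deriv_radialProfile hw hM hM0, if_pos hr]
    field_simp
  have hu : ∀ s, 0 < s → radialSol w s = radialSolDeriv w R * s * radialProfile w R s := by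
    intro s hs
    rw [radialProfile_of_pos w R hs]
    field_simp
  set c := radialSolDeriv w R with hc_def
  have h0 : (0 : ℝ) * radialSolDeriv w 0 - radialSol w 0 = 0 := by
    rw [zero_mul, radialSol_of_nonpos w le_rfl, sub_zero]
  have hL : ∫ r in Ioc 0 T, (r * radialSolDeriv w r - radialSol w r) * deriv k r =
      c * ∫ r in Ioc 0 T, r ^ 2 * deriv (radialProfile w R) r * deriv k r := by
    rw [← integral_const_mul]
    refine setIntegral_congr_fun measurableSet_Ioc fun r hr => ?_
    rw [hm r hr.1]; ring
  have hR' : ∫ s in Ioc 0 T, s * ((w s).toReal / 2 * radialSol w s) * k s =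
      c * ∫ s in Ioc 0 T, (w s).toReal / 2 * s ^ 2 * radialProfile w R s * k s := by
    rw [← integral_const_mul]
    refine setIntegral_congr_fun measurableSet_Ioc fun s hs => ?_
    rw [hu s hs.1]; ring
  rw [hL, hR', h0, zero_mul, sub_zero, hm T hT] at h
  have h' : c * (∫ r in Ioc 0 T, r ^ 2 * deriv (radialProfile w R) r * deriv k r) =
      c * (T ^ 2 * deriv (radialProfile w R) T * k T -
        ∫ s in Ioc 0 T, (w s).toReal / 2 * s ^ 2 * radialProfile w R s * k s) := by
    rw [h]; ring
  exact mul_left_cancel₀ hc.ne' h'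

/-- **The energy identity for the profile**: `∫_0^T r²(f'² + ½Wf²) dr = T² f'(T) f(T)` (`T > 0`).
[cite: LSSY2005, App. C, Thm. C.1 (C.8)] -/
theorem profile_energy_identity (hw : Measurable w) (hM : ∀ r, w r ≤ ENNReal.ofReal M) (hM0 : 0 ≤ M) (R : ℝ)
    {T : ℝ} (hT : 0 < T) :
    ∫ r in Ioc 0 T, r ^ 2 * (deriv (radialProfile w R) r ^ 2 + (w r).toReal / 2 * radialProfile w R r ^ 2) =
      T ^ 2 * deriv (radialProfile w R) T * radialProfile w R T := by
  set f := radialProfile w R with hf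
  have hfc : ContDiff ℝ 1 f := contDiff_radialProfile hw hM hM0
  have h := profile_flux_identity hw hM hM0 R hT hfc
  have h1 : IntegrableOn (fun r => r ^ 2 * deriv f r * deriv f r) (Ioc 0 T) := by
    have : Continuous fun r => r ^ 2 * deriv f r * deriv f r := by
      have := hfc.continuous_deriv le_rfl; fun_prop
    exact this.integrableOn_Icc.mono_set Ioc_subset_Icc_self
  have h2 : IntegrableOn (fun s => (w s).toReal / 2 * s ^ 2 * f s * f s) (Ioc 0 T) := by
    have heq : (fun s => (w s).toReal / 2 * s ^ 2 * f s * f s) = fun s => (w s).toReal / 2 * (s ^ 2 * f s * f s) := by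
      funext s; ring
    rw [heq]
    exact integrableOn_Ioc_pot_mul hw hM hM0 (by have := hfc.continuous; fun_prop) T
  calc ∫ r in Ioc 0 T, r ^ 2 * (deriv f r ^ 2 + (w r).toReal / 2 * f r ^ 2)
      = ∫ r in Ioc 0 T, (r ^ 2 * deriv f r * deriv f r + (w r).toReal / 2 * r ^ 2 * f r * f r) :=
        setIntegral_congr_fun measurableSet_Ioc fun r _ => by ring
    _ = (∫ r in Ioc 0 T, r ^ 2 * deriv f r * deriv f r) + ∫ s in Ioc 0 T, (w s).toReal / 2 * s ^ 2 * f s * f s :=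
        integral_add h1 h2
    _ = T ^ 2 * deriv f T * f T := by rw [h]; ring

/-- **The one-dimensional lower bound** (ground-state substitution on a ray): for `g ∈ C¹` and `T > 0`,
`∫_0^T r²(g'² + ½Wg²) dr ≥ T² f'(T) g(T)²/f(T)`; the difference is `∫_0^T r² f² ((g/f)')² ≥ 0`.
[cite: LSSY2005, App. C, Thm. C.1 and Lemma C.2] -/
theorem profile_ray_lower_bound (hw : Measurable w) (hM : ∀ r, w r ≤ ENNReal.ofReal M) (hM0 : 0 ≤ M) (R : ℝ)
    {T : ℝ} (hT : 0 < T) {g : ℝ → ℝ} (hg : ContDiff ℝ 1 g) :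
    T ^ 2 * deriv (radialProfile w R) T * g T ^ 2 / radialProfile w R T ≤
      ∫ r in Ioc 0 T, r ^ 2 * (deriv g r ^ 2 + (w r).toReal / 2 * g r ^ 2) := by
  have hfc : ContDiff ℝ 1 (radialProfile w R) := contDiff_radialProfile hw hM hM0
  have hfpos : ∀ r, 0 < (radialProfile w R) r := fun r => radialProfile_pos hw hM hM0 R r
  have hfd : ∀ r, HasDerivAt (radialProfile w R) (deriv (radialProfile w R) r) r := fun r => (hfc.differentiable one_ne_zero r).hasDerivAt
  have hgd : ∀ r, HasDerivAt g (deriv g r) r := fun r => (hg.differentiable one_ne_zero r).hasDerivAt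
  -- `k = g²/f`
  have hkc : ContDiff ℝ 1 (fun r => g r ^ 2 / (radialProfile w R) r) := (hg.pow 2).div hfc fun r => (hfpos r).ne'
  have hk' : ∀ r, deriv (fun r => g r ^ 2 / (radialProfile w R) r) r = (2 * g r * deriv g r * (radialProfile w R) r - g r ^ 2 * deriv (radialProfile w R) r) / (radialProfile w R) r ^ 2 := by
    intro r
    rw [(((hgd r).fun_pow 2).fun_div (hfd r) (hfpos r).ne').deriv]
    simp only [Nat.cast_ofNat]
    ring
  have hflux := profile_flux_identity hw hM hM0 R hT hkc
  -- pointwise: `r² f' k' ≤ r² g'²`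
  have hpt : ∀ r ∈ Ioc 0 T, r ^ 2 * deriv (radialProfile w R) r * deriv (fun r => g r ^ 2 / (radialProfile w R) r) r ≤ r ^ 2 * deriv g r ^ 2 := by
    intro r _
    rw [hk']
    have hf0 := hfpos r
    have key : r ^ 2 * deriv g r ^ 2 - r ^ 2 * deriv (radialProfile w R) r * ((2 * g r * deriv g r * (radialProfile w R) r - g r ^ 2 * deriv (radialProfile w R) r) / (radialProfile w R) r ^ 2) =
        r ^ 2 * (deriv g r - deriv (radialProfile w R) r * g r / (radialProfile w R) r) ^ 2 := by
      field_simp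
      ring
    nlinarith [key, mul_nonneg (sq_nonneg r) (sq_nonneg (deriv g r - deriv (radialProfile w R) r * g r / (radialProfile w R) r))]
  -- integrability
  have hi1 : IntegrableOn (fun r => r ^ 2 * deriv (radialProfile w R) r * deriv (fun r => g r ^ 2 / (radialProfile w R) r) r) (Ioc 0 T) := by
    have : Continuous fun r => r ^ 2 * deriv (radialProfile w R) r * deriv (fun r => g r ^ 2 / (radialProfile w R) r) r := by
      have := hfc.continuous_deriv le_rfl; have := hkc.continuous_deriv le_rfl; fun_prop
    exact this.integrableOn_Icc.mono_set Ioc_subset_Icc_self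
  have hi2 : IntegrableOn (fun r => r ^ 2 * deriv g r ^ 2) (Ioc 0 T) := by
    have : Continuous fun r => r ^ 2 * deriv g r ^ 2 := by
      have := hg.continuous_deriv le_rfl; fun_prop
    exact this.integrableOn_Icc.mono_set Ioc_subset_Icc_self
  have hi4 : IntegrableOn (fun s => s ^ 2 * ((w s).toReal / 2 * g s ^ 2)) (Ioc 0 T) := by
    have heq : (fun s => s ^ 2 * ((w s).toReal / 2 * g s ^ 2)) = fun s => (w s).toReal / 2 * (s ^ 2 * g s ^ 2) := by
      funext s; ring
    rw [heq]
    exact integrableOn_Ioc_pot_mul hw hM hM0 (by have := hg.continuous; fun_prop) T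
  -- `f k = g²`
  have hfk : ∀ s, (w s).toReal / 2 * s ^ 2 * (radialProfile w R) s * (g s ^ 2 / (radialProfile w R) s) = s ^ 2 * ((w s).toReal / 2 * g s ^ 2) := by
    intro s
    have := (hfpos s).ne'
    field_simp
  have hkT : T ^ 2 * deriv (radialProfile w R) T * (g T ^ 2 / (radialProfile w R) T) = T ^ 2 * deriv (radialProfile w R) T * g T ^ 2 / (radialProfile w R) T := by
    ring
  have hI : ∫ r in Ioc 0 T, r ^ 2 * deriv (radialProfile w R) r * deriv (fun r => g r ^ 2 / (radialProfile w R) r) r ≤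
      ∫ r in Ioc 0 T, r ^ 2 * deriv g r ^ 2 :=
    setIntegral_mono_on hi1 hi2 measurableSet_Ioc hpt
  rw [hflux, hkT] at hI
  simp_rw [hfk] at hI
  calc T ^ 2 * deriv (radialProfile w R) T * g T ^ 2 / (radialProfile w R) T
      ≤ (∫ r in Ioc 0 T, r ^ 2 * deriv g r ^ 2) + ∫ s in Ioc 0 T, s ^ 2 * ((w s).toReal / 2 * g s ^ 2) := by
        linarith
    _ = ∫ r in Ioc 0 T, r ^ 2 * (deriv g r ^ 2 + (w r).toReal / 2 * g r ^ 2) := by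
        rw [← integral_add hi2 hi4]
        refine setIntegral_congr_fun measurableSet_Ioc fun r _ => ?_
        ring

end Flux


/-! ### `a_ODE ≤ a`: the ray argument -/

section LowerBound

variable {w : ℝ → ℝ≥0∞} {M R : ℝ}

/-- The ray density of a `C¹` function for a bounded potential, as `ofReal` of a real density.
[folklore] -/
theorem rayDensity_eq_ofReal (hM : ∀ r, w r ≤ ENNReal.ofReal M) (g : ℝ → ℝ) (r : ℝ) :
    rayDensity w g r = ENNReal.ofReal (r ^ 2 * (deriv g r ^ 2 + (w r).toReal / 2 * g r ^ 2)) := by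
  have hW : 0 ≤ (w r).toReal := ENNReal.toReal_nonneg
  rw [rayDensity, ← ofReal_toReal_pot hM r, ENNReal.toReal_ofReal hW,
    ENNReal.ofReal_mul (sq_nonneg _), ENNReal.ofReal_add (sq_nonneg _) (by positivity),
    show (w r).toReal / 2 * g r ^ 2 = 2⁻¹ * (w r).toReal * g r ^ 2 by ring,
    ENNReal.ofReal_mul (by positivity), ENNReal.ofReal_mul (by positivity),
    ENNReal.ofReal_inv_of_pos two_pos, ENNReal.ofReal_ofNat]

/-- On a bounded interval the ray energy of a `C¹` function is the `ofReal` of a Bochner integral.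
[folklore] -/
theorem lintegral_Ioc_rayDensity (hw : Measurable w) (hM : ∀ r, w r ≤ ENNReal.ofReal M) (hM0 : 0 ≤ M)
    {g : ℝ → ℝ} (hg : ContDiff ℝ 1 g) (T : ℝ) :
    ∫⁻ r in Ioc 0 T, rayDensity w g r =
      ENNReal.ofReal (∫ r in Ioc 0 T, r ^ 2 * (deriv g r ^ 2 + (w r).toReal / 2 * g r ^ 2)) := by
  have h1 : IntegrableOn (fun r => r ^ 2 * deriv g r ^ 2) (Ioc 0 T) := by
    have : Continuous fun r => r ^ 2 * deriv g r ^ 2 := by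
      have := hg.continuous_deriv le_rfl; fun_prop
    exact this.integrableOn_Icc.mono_set Ioc_subset_Icc_self
  have h2 : IntegrableOn (fun s => (w s).toReal / 2 * (s ^ 2 * g s ^ 2)) (Ioc 0 T) :=
    integrableOn_Ioc_pot_mul hw hM hM0 (by have := hg.continuous; fun_prop) T
  have hint : IntegrableOn (fun r => r ^ 2 * (deriv g r ^ 2 + (w r).toReal / 2 * g r ^ 2)) (Ioc 0 T) := by
    have heq : (fun r => r ^ 2 * (deriv g r ^ 2 + (w r).toReal / 2 * g r ^ 2)) =
        fun r => r ^ 2 * deriv g r ^ 2 + (w r).toReal / 2 * (r ^ 2 * g r ^ 2) := by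
      funext r; ring
    rw [heq]
    exact h1.add h2
  simp_rw [rayDensity_eq_ofReal hM]
  rw [← ofReal_integral_eq_lintegral_ofReal hint]
  filter_upwards [ae_restrict_mem measurableSet_Ioc] with r hr
  have : 0 ≤ (w r).toReal / 2 := div_nonneg ENNReal.toReal_nonneg zero_le_two
  positivity

/-- **`T² f'(T) = a` beyond the range** (`T ≥ R > 0`). [cite: LSSY2005, (2.5) and Thm. C.1 (C.7)] -/
theorem sq_mul_deriv_radialProfile (hw : Measurable w) (hM : ∀ r, w r ≤ ENNReal.ofReal M) (hM0 : 0 ≤ M)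
    (hR : 0 < R) (hwR : ∀ s, R < s → w s = 0) {T : ℝ} (hT : R ≤ T) :
    T ^ 2 * deriv (radialProfile w R) T = odeScatteringLength w R := by
  have hT0 : 0 < T := hR.trans_le hT
  have hc := slope_pos hw hM hM0 R
  rw [deriv_radialProfile hw hM hM0, if_pos hT0, mul_deriv_sub_sol_of_ge hw hM hM0 hR.le hwR hT]
  field_simp

/-- **The scattering length bounds every ray energy from below**: if `g ∈ C¹` equals `1` on
`[T, ∞)` with `T ≥ R`, then `∫_0^∞ r²(g'² + ½wg²) ≥ a`. [cite: LSSY2005, App. C, Thm. C.1 (C.8)] -/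
theorem ofReal_odeScatteringLength_le_lintegral_rayDensity (hw : Measurable w) (hM : ∀ r, w r ≤ ENNReal.ofReal M)
    (hM0 : 0 ≤ M) (hR : 0 < R) (hwR : ∀ s, R < s → w s = 0) {g : ℝ → ℝ} (hg : ContDiff ℝ 1 g)
    {T : ℝ} (hT : R ≤ T) (hg1 : g T = 1) :
    ENNReal.ofReal (odeScatteringLength w R) ≤ ∫⁻ r in Ioi 0, rayDensity w g r := by
  have hT0 : 0 < T := hR.trans_le hT
  have ha := odeScatteringLength_nonneg hw hM hM0 hR.le
  have hf0 := radialProfile_pos hw hM hM0 R T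
  have hf1 := radialProfile_le_one hw hM hM0 hR hwR T
  have hlow := profile_ray_lower_bound hw hM hM0 R hT0 hg
  rw [hg1, one_pow, mul_one, sq_mul_deriv_radialProfile hw hM hM0 hR hwR hT] at hlow
  have hdiv : odeScatteringLength w R ≤ odeScatteringLength w R / radialProfile w R T := by
    rw [le_div_iff₀ hf0]
    exact mul_le_of_le_one_right ha hf1
  calc ENNReal.ofReal (odeScatteringLength w R)
      ≤ ENNReal.ofReal (∫ r in Ioc 0 T, r ^ 2 * (deriv g r ^ 2 + (w r).toReal / 2 * g r ^ 2)) :=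
        ENNReal.ofReal_le_ofReal (hdiv.trans hlow)
    _ = ∫⁻ r in Ioc 0 T, rayDensity w g r := (lintegral_Ioc_rayDensity hw hM hM0 hg T).symm
    _ ≤ ∫⁻ r in Ioi 0, rayDensity w g r := lintegral_mono_set Ioc_subset_Ioi_self

/-- **The variational scattering length is at least the ODE scattering length**:
`a_ODE ≤ a = (4π)⁻¹ inf 𝓔` (every admissible `φ` has `𝓔[φ] ≥ ∫_{S²} e[φ(·ω)] dσ ≥ 4π a_ODE`).
[cite: LSSY2005, App. C, Thm. C.1 (C.4)–(C.8)] -/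
theorem ofReal_odeScatteringLength_le_scatteringLength (hw : Measurable w) (hM : ∀ r, w r ≤ ENNReal.ofReal M)
    (hM0 : 0 ≤ M) (hR : 0 < R) (hwR : ∀ s, R < s → w s = 0) :
    ENNReal.ofReal (odeScatteringLength w R) ≤ scatteringLength w := by
  have h4 : ENNReal.ofReal (4 * Real.pi) ≠ 0 := by rw [ENNReal.ofReal_ne_zero_iff]; positivity
  have key : ∀ φ : Space → ℝ, IsScatteringTrial φ →
      ENNReal.ofReal (4 * Real.pi) * ENNReal.ofReal (odeScatteringLength w R) ≤ scatteringFunctional w φ := by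
    intro φ hφ
    obtain ⟨Rφ, hRφ⟩ := hφ.exists_eq_one
    set T : ℝ := max R (max Rφ 0 + 1) with hT
    have hRT : R ≤ T := le_max_left _ _
    have hRφT : Rφ < T := by
      have : max Rφ 0 + 1 ≤ T := le_max_right _ _
      linarith [le_max_left Rφ 0]
    have hT0 : 0 < T := hR.trans_le hRT
    have hray : ∀ ω : sphere (0 : Space) 1,
        ENNReal.ofReal (odeScatteringLength w R) ≤ rayEnergy w φ ω := by
      intro ω
      refine ofReal_odeScatteringLength_le_lintegral_rayDensity hw hM hM0 hR hwR (contDiff_rayFun hφ.1 ω) hRT ?_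
      refine hRφ _ ?_
      rw [norm_smul, norm_eq_of_mem_sphere ω, mul_one, Real.norm_of_nonneg hT0.le]
      exact hRφT
    calc ENNReal.ofReal (4 * Real.pi) * ENNReal.ofReal (odeScatteringLength w R)
        = ∫⁻ _ω, ENNReal.ofReal (odeScatteringLength w R) ∂sphereMeasure := by
          rw [lintegral_const, sphereMeasure_univ, mul_comm]
      _ ≤ ∫⁻ ω, rayEnergy w φ ω ∂sphereMeasure := lintegral_mono fun ω => hray ω
      _ ≤ scatteringFunctional w φ := lintegral_rayEnergy_le hφ.1 hw
  have hinf : ENNReal.ofReal (4 * Real.pi) * ENNReal.ofReal (odeScatteringLength w R) ≤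
      ⨅ (φ : Space → ℝ) (_ : IsScatteringTrial φ), scatteringFunctional w φ :=
    le_iInf₂ key
  calc ENNReal.ofReal (odeScatteringLength w R)
      = (ENNReal.ofReal (4 * Real.pi))⁻¹ *
          (ENNReal.ofReal (4 * Real.pi) * ENNReal.ofReal (odeScatteringLength w R)) := by
        rw [← mul_assoc, ENNReal.inv_mul_cancel h4 ENNReal.ofReal_ne_top, one_mul]
    _ ≤ (ENNReal.ofReal (4 * Real.pi))⁻¹ * ⨅ (φ : Space → ℝ) (_ : IsScatteringTrial φ), scatteringFunctional w φ :=
        mul_le_mul_right hinf _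
    _ = scatteringLength w := rfl

end LowerBound


/-! ### `a ≤ a_ODE`: radial trial functions -/

section UpperBound

variable {w : ℝ → ℝ≥0∞} {M R : ℝ}

/-- **The energy of a radial `C¹` function in polar coordinates**: `𝓔[g ∘ |·|] = 4π ∫_0^∞ r²(g'² + ½vg²) dr`.
[cite: LSSY2005, App. C (C.4)] -/
theorem scatteringFunctional_radialFun {g : ℝ → ℝ} (hg : ContDiff ℝ 1 g) {v : ℝ → ℝ≥0∞} (hv : Measurable v) :
    scatteringFunctional v (radialFun g) = ENNReal.ofReal (4 * Real.pi) * ∫⁻ r in Ioi (0 : ℝ), rayDensity v g r := by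
  have h := profileEnergy_radialFun hg hv
  rw [profileEnergy] at h
  exact (ENNReal.mul_right_inj two_ne_zero ENNReal.ofNat_ne_top).mp h

/-! The radial trial profiles are `g_T = f + χ_T (1 - f)` with `χ_T = smoothStep T T` the smooth
step across `[T, 2T]`: `g_T = f` on `[0, T]`, `g_T = 1` on `[2T, ∞)` [LSSY2005, App. C, Thm. C.1,
the passage `R → ∞` in (C.8)]. They are written out as lambdas below (no auxiliary definition). -/

/-- The trial profiles are `C¹`. [cite: LSSY2005, App. C, Thm. C.1] -/
theorem trialProfile_contDiff (hw : Measurable w) (hM : ∀ r, w r ≤ ENNReal.ofReal M) (hM0 : 0 ≤ M) (R T : ℝ) :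
    ContDiff ℝ 1 ((fun r => radialProfile w R r + smoothStep T T r * (1 - radialProfile w R r))) :=
  (contDiff_radialProfile hw hM hM0).add
    ((smoothStep_contDiff T T).mul (contDiff_const.sub (contDiff_radialProfile hw hM hM0)))

/-- The derivative of the trial profile (product rule). [cite: LSSY2005, App. C, Thm. C.1] -/
theorem hasDerivAt_trialProfile (hw : Measurable w) (hM : ∀ r, w r ≤ ENNReal.ofReal M) (hM0 : 0 ≤ M) (R T r : ℝ) :
    HasDerivAt ((fun r => radialProfile w R r + smoothStep T T r * (1 - radialProfile w R r)))
      (deriv (radialProfile w R) r + (deriv (smoothStep T T) r * (1 - radialProfile w R r) +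
        smoothStep T T r * (0 - deriv (radialProfile w R) r))) r := by
  have hf : HasDerivAt (radialProfile w R) (deriv (radialProfile w R) r) r :=
    ((contDiff_radialProfile hw hM hM0).differentiable one_ne_zero r).hasDerivAt
  have hS : HasDerivAt (smoothStep T T) (deriv (smoothStep T T) r) r :=
    ((smoothStep_contDiff T T (n := 1)).differentiable one_ne_zero r).hasDerivAt
  exact hf.add (hS.mul ((hasDerivAt_const r (1 : ℝ)).sub hf))

/-- `g_T' = (1 - χ_T) f' + χ_T' (1 - f)`. [cite: LSSY2005, App. C, Thm. C.1] -/
theorem deriv_trialProfile (hw : Measurable w) (hM : ∀ r, w r ≤ ENNReal.ofReal M) (hM0 : 0 ≤ M) (R T r : ℝ) :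
    deriv ((fun r => radialProfile w R r + smoothStep T T r * (1 - radialProfile w R r))) r =
      (1 - smoothStep T T r) * deriv (radialProfile w R) r + deriv (smoothStep T T) r * (1 - radialProfile w R r) := by
  rw [(hasDerivAt_trialProfile hw hM hM0 R T r).deriv]; ring

/-- `g_T = f` on `(-∞, T]`. [cite: LSSY2005, App. C, Thm. C.1] -/
theorem trialProfile_of_le {T r : ℝ} (hT : 0 < T) (hr : r ≤ T) :
    radialProfile w R r + smoothStep T T r * (1 - radialProfile w R r) = radialProfile w R r := by
  rw [smoothStep_of_le hT hr, zero_mul, add_zero]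

/-- `g_T = 1` on `[2T, ∞)`. [cite: LSSY2005, App. C, Thm. C.1] -/
theorem trialProfile_of_ge {T r : ℝ} (hT : 0 < T) (hr : 2 * T ≤ r) :
    radialProfile w R r + smoothStep T T r * (1 - radialProfile w R r) = 1 := by
  rw [smoothStep_of_ge hT (by linarith), one_mul, add_sub_cancel]

/-- `g_T' = f'` on `(-∞, T]`. [cite: LSSY2005, App. C, Thm. C.1] -/
theorem deriv_trialProfile_of_le (hw : Measurable w) (hM : ∀ r, w r ≤ ENNReal.ofReal M) (hM0 : 0 ≤ M)
    {T r : ℝ} (hT : 0 < T) (hr : r ≤ T) : deriv ((fun r => radialProfile w R r + smoothStep T T r * (1 - radialProfile w R r))) r = deriv (radialProfile w R) r := by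
  rw [deriv_trialProfile hw hM hM0, smoothStep_of_le hT hr, deriv_smoothStep_of_le hT hr]; ring

/-- `g_T' = 0` on `[2T, ∞)`. [cite: LSSY2005, App. C, Thm. C.1] -/
theorem deriv_trialProfile_of_ge (hw : Measurable w) (hM : ∀ r, w r ≤ ENNReal.ofReal M) (hM0 : 0 ≤ M)
    {T r : ℝ} (hT : 0 < T) (hr : 2 * T ≤ r) : deriv ((fun r => radialProfile w R r + smoothStep T T r * (1 - radialProfile w R r))) r = 0 := by
  rw [deriv_trialProfile hw hM hM0, smoothStep_of_ge hT (by linarith), deriv_smoothStep_of_ge hT (by linarith)]; ring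

/-- `g_T'(0) = 0` (`T > 0`). [cite: LSSY2005, App. C, Thm. C.1] -/
theorem deriv_trialProfile_zero (hw : Measurable w) (hM : ∀ r, w r ≤ ENNReal.ofReal M) (hM0 : 0 ≤ M)
    {T : ℝ} (hT : 0 < T) : deriv ((fun r => radialProfile w R r + smoothStep T T r * (1 - radialProfile w R r))) 0 = 0 := by
  rw [deriv_trialProfile_of_le hw hM hM0 hT hT.le, deriv_radialProfile_zero hw hM hM0]

/-- `0 ≤ g_T ≤ 1` (`g_T = (1 - χ_T) f + χ_T` with `0 < f ≤ 1`). [cite: LSSY2005, App. C, Thm. C.1] -/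
theorem trialProfile_mem (hw : Measurable w) (hM : ∀ r, w r ≤ ENNReal.ofReal M) (hM0 : 0 ≤ M)
    (hR : 0 < R) (hwR : ∀ s, R < s → w s = 0) (T r : ℝ) :
    0 ≤ radialProfile w R r + smoothStep T T r * (1 - radialProfile w R r) ∧
      radialProfile w R r + smoothStep T T r * (1 - radialProfile w R r) ≤ 1 := by
  have h0 := radialProfile_pos hw hM hM0 R r
  have h1 := radialProfile_le_one hw hM hM0 hR hwR r
  have hS0 := smoothStep_nonneg (r₀ := T) (θ := T) r
  have hS1 := smoothStep_le_one (r₀ := T) (θ := T) r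
  constructor <;> nlinarith [mul_nonneg hS0 (sub_nonneg.mpr h1), mul_nonneg (sub_nonneg.mpr hS1) h0.le]

/-- The radialised trial profile is an admissible scattering trial function. [cite: LSSY2005, App. C, Thm. C.1] -/
theorem isScatteringTrial_trialProfile (hw : Measurable w) (hM : ∀ r, w r ≤ ENNReal.ofReal M) (hM0 : 0 ≤ M)
    {T : ℝ} (hT : 0 < T) : IsScatteringTrial (radialFun ((fun r => radialProfile w R r + smoothStep T T r * (1 - radialProfile w R r)))) := by
  refine ⟨radialFun_contDiff_of_deriv_zero (trialProfile_contDiff hw hM hM0 R T)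
    (deriv_trialProfile_zero hw hM hM0 hT), ?_⟩
  refine HasCompactSupport.intro (isCompact_closedBall (0 : Space) (2 * T)) fun x hx => ?_
  rw [mem_closedBall, dist_zero_right, not_le] at hx
  simp only [radialFun, trialProfile_of_ge hT hx.le, sub_self]

/-- Beyond the range the derivative of the profile is `a/r²`. [cite: LSSY2005, Thm. C.1 (C.7)] -/
theorem deriv_radialProfile_of_ge (hw : Measurable w) (hM : ∀ r, w r ≤ ENNReal.ofReal M) (hM0 : 0 ≤ M)
    (hR : 0 < R) (hwR : ∀ s, R < s → w s = 0) {r : ℝ} (hr : R ≤ r) :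
    deriv (radialProfile w R) r = odeScatteringLength w R / r ^ 2 := by
  have hr0 : 0 < r := hR.trans_le hr
  have h := sq_mul_deriv_radialProfile hw hM hM0 hR hwR hr
  field_simp
  linarith

/-- **The derivative of the trial profile on the gluing layer** `[T, 2T]`, `T ≥ R`:
`|g_T'| ≤ (1 + M_χ) a/T²`. [cite: LSSY2005, App. C, Thm. C.1] -/
theorem abs_deriv_trialProfile_le (hw : Measurable w) (hM : ∀ r, w r ≤ ENNReal.ofReal M) (hM0 : 0 ≤ M)
    (hR : 0 < R) (hwR : ∀ s, R < s → w s = 0) {Mχ : ℝ} (hMχ0 : 0 ≤ Mχ)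
    (hMχ : ∀ y ∈ Icc (0 : ℝ) 1, |deriv Real.smoothTransition y| ≤ Mχ)
    {T r : ℝ} (hRT : R ≤ T) (hr : T < r) :
    |deriv ((fun r => radialProfile w R r + smoothStep T T r * (1 - radialProfile w R r))) r| ≤ (1 + Mχ) * odeScatteringLength w R / T ^ 2 := by
  have hT0 : 0 < T := hR.trans_le hRT
  have hr0 : 0 < r := hT0.trans hr
  have hRr : R < r := hRT.trans_lt hr
  have ha := odeScatteringLength_nonneg hw hM hM0 hR.le
  have hS0 := smoothStep_nonneg (r₀ := T) (θ := T) r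
  have hS1 := smoothStep_le_one (r₀ := T) (θ := T) r
  have hf' : deriv (radialProfile w R) r = odeScatteringLength w R / r ^ 2 :=
    deriv_radialProfile_of_ge hw hM hM0 hR hwR hRr.le
  have hf : 1 - radialProfile w R r = odeScatteringLength w R / r := by
    rw [radialProfile_eq_one_sub_div hw hM hM0 hR.le le_rfl hwR hRr]; ring
  -- the step derivative is bounded by `Mχ/T` everywhere
  have hS' : |deriv (smoothStep T T) r| ≤ Mχ / T := by
    rcases le_or_gt r (T + T) with h2 | h2
    · exact abs_deriv_smoothStep_le hT0 hMχ ⟨hr.le, h2⟩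
    · rw [deriv_smoothStep_of_ge hT0 h2.le, abs_zero]; positivity
  rw [deriv_trialProfile hw hM hM0, hf', hf]
  have h1 : |(1 - smoothStep T T r) * (odeScatteringLength w R / r ^ 2)| ≤ odeScatteringLength w R / T ^ 2 := by
    rw [abs_mul, abs_of_nonneg (by linarith), abs_of_nonneg (by positivity)]
    calc (1 - smoothStep T T r) * (odeScatteringLength w R / r ^ 2) ≤ 1 * (odeScatteringLength w R / r ^ 2) := by
          gcongr; linarith
      _ ≤ odeScatteringLength w R / T ^ 2 := by rw [one_mul]; gcongr
  have h2 : |deriv (smoothStep T T) r * (odeScatteringLength w R / r)| ≤ Mχ * odeScatteringLength w R / T ^ 2 := by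
    rw [abs_mul, abs_of_nonneg (div_nonneg ha hr0.le)]
    calc |deriv (smoothStep T T) r| * (odeScatteringLength w R / r) ≤ Mχ / T * (odeScatteringLength w R / T) := by
          gcongr
      _ = Mχ * odeScatteringLength w R / T ^ 2 := by field_simp
  calc |(1 - smoothStep T T r) * (odeScatteringLength w R / r ^ 2) + deriv (smoothStep T T) r * (odeScatteringLength w R / r)|
      ≤ |(1 - smoothStep T T r) * (odeScatteringLength w R / r ^ 2)| + |deriv (smoothStep T T) r * (odeScatteringLength w R / r)| :=
        abs_add_le _ _
    _ ≤ odeScatteringLength w R / T ^ 2 + Mχ * odeScatteringLength w R / T ^ 2 := add_le_add h1 h2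
    _ = (1 + Mχ) * odeScatteringLength w R / T ^ 2 := by ring

/-- **The energy of the trial profile**: `∫_0^∞ r²(g_T'² + ½wg_T²) ≤ a + 4(1+M_χ)²a²/T` for `T ≥ R`.
[cite: LSSY2005, App. C, Thm. C.1 (C.8)] -/
theorem lintegral_rayDensity_trialProfile_le (hw : Measurable w) (hM : ∀ r, w r ≤ ENNReal.ofReal M) (hM0 : 0 ≤ M)
    (hR : 0 < R) (hwR : ∀ s, R < s → w s = 0) {Mχ : ℝ} (hMχ0 : 0 ≤ Mχ)
    (hMχ : ∀ y ∈ Icc (0 : ℝ) 1, |deriv Real.smoothTransition y| ≤ Mχ) {T : ℝ} (hRT : R ≤ T) :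
    ∫⁻ r in Ioi 0, rayDensity w ((fun r => radialProfile w R r + smoothStep T T r * (1 - radialProfile w R r))) r ≤
      ENNReal.ofReal (odeScatteringLength w R) +
        ENNReal.ofReal (4 * (1 + Mχ) ^ 2 * odeScatteringLength w R ^ 2 / T) := by
  have hT0 : 0 < T := hR.trans_le hRT
  have ha := odeScatteringLength_nonneg hw hM hM0 hR.le
  set g := (fun r => radialProfile w R r + smoothStep T T r * (1 - radialProfile w R r)) with hg
  have hgc : ContDiff ℝ 1 g := trialProfile_contDiff hw hM hM0 R T
  -- split `(0, ∞) = (0, T] ∪ (T, 2T] ∪ (2T, ∞)`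
  rw [lintegral_Ioi_eq_add hT0.le, lintegral_Ioi_eq_add (show T ≤ 2 * T by linarith)]
  -- inner part: the energy identity
  have hin : ∫⁻ r in Ioc 0 T, rayDensity w g r ≤ ENNReal.ofReal (odeScatteringLength w R) := by
    have heq : ∫⁻ r in Ioc 0 T, rayDensity w g r = ∫⁻ r in Ioc 0 T, rayDensity w (radialProfile w R) r := by
      refine setLIntegral_congr_fun measurableSet_Ioc fun r hr => ?_
      rw [rayDensity_eq_ofReal hM, rayDensity_eq_ofReal hM, hg, deriv_trialProfile_of_le hw hM hM0 hT0 hr.2]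
      beta_reduce
      rw [trialProfile_of_le hT0 hr.2]
    rw [heq, lintegral_Ioc_rayDensity hw hM hM0 (contDiff_radialProfile hw hM hM0) T,
      profile_energy_identity hw hM hM0 R hT0, sq_mul_deriv_radialProfile hw hM hM0 hR hwR hRT]
    refine ENNReal.ofReal_le_ofReal (mul_le_of_le_one_right ha (radialProfile_le_one hw hM hM0 hR hwR T))
  -- layer: pointwise derivative bound, no potential
  have hlay : ∫⁻ r in Ioc T (2 * T), rayDensity w g r ≤
      ENNReal.ofReal (4 * (1 + Mχ) ^ 2 * odeScatteringLength w R ^ 2 / T) := by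
    set K : ℝ := (1 + Mχ) * odeScatteringLength w R / T ^ 2 with hK
    have hK0 : 0 ≤ K := by positivity
    have hpt : ∀ r ∈ Ioc T (2 * T), rayDensity w g r ≤ ENNReal.ofReal ((2 * T) ^ 2 * K ^ 2) := by
      intro r hr
      have hwr : w r = 0 := hwR r (hRT.trans_lt hr.1)
      rw [rayDensity_of_eq_zero hwr]
      refine ENNReal.ofReal_le_ofReal ?_
      have hd : |deriv g r| ≤ K := abs_deriv_trialProfile_le hw hM hM0 hR hwR hMχ0 hMχ hRT hr.1
      have h1 : deriv g r ^ 2 ≤ K ^ 2 := by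
        rw [← sq_abs]; exact pow_le_pow_left₀ (abs_nonneg _) hd 2
      have h2 : r ^ 2 ≤ (2 * T) ^ 2 := pow_le_pow_left₀ (hT0.le.trans hr.1.le) hr.2 2
      exact mul_le_mul h2 h1 (sq_nonneg _) (by positivity)
    calc ∫⁻ r in Ioc T (2 * T), rayDensity w g r ≤ ∫⁻ _ in Ioc T (2 * T), ENNReal.ofReal ((2 * T) ^ 2 * K ^ 2) :=
          setLIntegral_mono' measurableSet_Ioc hpt
      _ = ENNReal.ofReal ((2 * T) ^ 2 * K ^ 2) * ENNReal.ofReal (2 * T - T) := by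
          rw [setLIntegral_const, Real.volume_Ioc]
      _ = ENNReal.ofReal (4 * (1 + Mχ) ^ 2 * odeScatteringLength w R ^ 2 / T) := by
          rw [← ENNReal.ofReal_mul (by positivity)]
          congr 1
          rw [hK]; field_simp; ring
  -- tail: zero
  have htail : ∫⁻ r in Ioi (2 * T), rayDensity w g r = 0 := by
    refine (setLIntegral_congr_fun measurableSet_Ioi fun r hr => ?_).trans lintegral_zero
    have hwr : w r = 0 := hwR r (by have := mem_Ioi.mp hr; linarith)
    rw [rayDensity_of_eq_zero hwr, hg, deriv_trialProfile_of_ge hw hM hM0 hT0 (le_of_lt hr)]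
    simp
  rw [htail, add_zero]
  exact add_le_add hin hlay

/-- **The variational scattering length is at most the ODE scattering length.**
[cite: LSSY2005, App. C, Thm. C.1 (C.8)] -/
theorem scatteringLength_le_ofReal_odeScatteringLength (hw : Measurable w) (hM : ∀ r, w r ≤ ENNReal.ofReal M)
    (hM0 : 0 ≤ M) (hR : 0 < R) (hwR : ∀ s, R < s → w s = 0) :
    scatteringLength w ≤ ENNReal.ofReal (odeScatteringLength w R) := by
  obtain ⟨Mχ, hMχ0, hMχ⟩ := exists_bound_deriv_smoothTransition
  have ha := odeScatteringLength_nonneg hw hM hM0 hR.le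
  set K : ℝ := 4 * (1 + Mχ) ^ 2 * odeScatteringLength w R ^ 2 with hK
  have hK0 : 0 ≤ K := by positivity
  have h4 : ENNReal.ofReal (4 * Real.pi) ≠ 0 := by rw [ENNReal.ofReal_ne_zero_iff]; positivity
  -- for every `T ≥ R`: `a_var ≤ a + K/T`
  have hT : ∀ T : ℝ, R ≤ T → scatteringLength w ≤ ENNReal.ofReal (odeScatteringLength w R) + ENNReal.ofReal (K / T) := by
    intro T hRT
    have hT0 : 0 < T := hR.trans_le hRT
    have htrial := isScatteringTrial_trialProfile (R := R) hw hM hM0 hT0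
    calc scatteringLength w
        ≤ (ENNReal.ofReal (4 * Real.pi))⁻¹ * scatteringFunctional w (radialFun ((fun r => radialProfile w R r + smoothStep T T r * (1 - radialProfile w R r)))) :=
          scatteringLength_le htrial
      _ = ∫⁻ r in Ioi 0, rayDensity w ((fun r => radialProfile w R r + smoothStep T T r * (1 - radialProfile w R r))) r := by
          rw [scatteringFunctional_radialFun (trialProfile_contDiff hw hM hM0 R T) hw, ← mul_assoc,
            ENNReal.inv_mul_cancel h4 ENNReal.ofReal_ne_top, one_mul]
      _ ≤ ENNReal.ofReal (odeScatteringLength w R) + ENNReal.ofReal (K / T) :=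
          lintegral_rayDensity_trialProfile_le hw hM hM0 hR hwR hMχ0 hMχ hRT
  -- let `T → ∞`
  refine ENNReal.le_of_forall_pos_le_add fun ε hε _ => ?_
  have hε' : (0 : ℝ) < ε := by exact_mod_cast hε
  obtain ⟨T, hT1⟩ : ∃ T : ℝ, max R (K / ε) < T := exists_gt _
  have hRT : R ≤ T := (le_max_left _ _).trans hT1.le
  have hT0 : 0 < T := hR.trans_le hRT
  have hKT : K / T ≤ ε := by
    rw [div_le_iff₀ hT0]
    have : K / (ε : ℝ) < T := (le_max_right _ _).trans_lt hT1
    rw [div_lt_iff₀ hε'] at this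
    nlinarith
  calc scatteringLength w ≤ ENNReal.ofReal (odeScatteringLength w R) + ENNReal.ofReal (K / T) := hT T hRT
    _ ≤ ENNReal.ofReal (odeScatteringLength w R) + ε := by
        gcongr
        exact (ENNReal.ofReal_le_ofReal hKT).trans_eq ENNReal.ofReal_coe_nnreal

end UpperBound


/-! ### `a = a_ODE` and `∫ w f = 8πa` -/

section Identification

variable {w : ℝ → ℝ≥0∞} {M R : ℝ}

/-- **LSSY Theorem C.1, the identification `a = lim (r - u(r)/u'(r))`**: for a bounded measurable
potential of finite range, the variational scattering length (C.4)–(C.8) equals the scattering length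
read off the zero-energy radial solution (2.5). [cite: LSSY2005, App. C, Thm. C.1 and (2.5)] -/
theorem scatteringLength_eq_ofReal_odeScatteringLength (hw : Measurable w) (hM : ∀ r, w r ≤ ENNReal.ofReal M)
    (hM0 : 0 ≤ M) (hR : 0 < R) (hwR : ∀ s, R < s → w s = 0) :
    scatteringLength w = ENNReal.ofReal (odeScatteringLength w R) :=
  le_antisymm (scatteringLength_le_ofReal_odeScatteringLength hw hM hM0 hR hwR)
    (ofReal_odeScatteringLength_le_scatteringLength hw hM hM0 hR hwR)

/-- Real form: `a = R - u(R)/u'(R)`. [cite: LSSY2005, App. C, Thm. C.1 and (2.5)] -/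
theorem toReal_scatteringLength_eq (hw : Measurable w) (hM : ∀ r, w r ≤ ENNReal.ofReal M)
    (hM0 : 0 ≤ M) (hR : 0 < R) (hwR : ∀ s, R < s → w s = 0) :
    (scatteringLength w).toReal = odeScatteringLength w R := by
  rw [scatteringLength_eq_ofReal_odeScatteringLength hw hM hM0 hR hwR,
    ENNReal.toReal_ofReal (odeScatteringLength_nonneg hw hM hM0 hR.le)]

/-- **`∫_0^R ½W(s) s² f(s) ds = a`** (the total flux: `r u' - u` from `0` to `R`).
[cite: LSSY2005, (2.5); Fournais2020, App. A (A.5)] -/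
theorem integral_pot_sq_profile (hw : Measurable w) (hM : ∀ r, w r ≤ ENNReal.ofReal M) (hM0 : 0 ≤ M)
    (hR : 0 < R) (hwR : ∀ s, R < s → w s = 0) :
    ∫ s in Ioc 0 R, (w s).toReal / 2 * s ^ 2 * radialProfile w R s = odeScatteringLength w R := by
  have hc := slope_pos hw hM hM0 R
  have hflux := mul_deriv_sub_sol_eq hw hM hM0 hR.le
  rw [mul_deriv_sub_sol_of_ge hw hM hM0 hR.le hwR le_rfl] at hflux
  have hu : ∀ s, 0 < s → radialSol w s = radialSolDeriv w R * s * radialProfile w R s := by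
    intro s hs
    rw [radialProfile_of_pos w R hs]
    field_simp
  have heq : ∫ s in Ioc 0 R, s * ((w s).toReal / 2 * radialSol w s) =
      radialSolDeriv w R * ∫ s in Ioc 0 R, (w s).toReal / 2 * s ^ 2 * radialProfile w R s := by
    rw [← integral_const_mul]
    refine setIntegral_congr_fun measurableSet_Ioc fun s hs => ?_
    rw [hu s hs.1]; ring
  rw [heq] at hflux
  have h := mul_left_cancel₀ hc.ne' (hflux.symm.trans (mul_comm _ _))
  exact h

/-- **`∫ v(1 - ω) = 8πa`** for the profile of a bounded finite-range potential:
`∫_{ℝ³} w(|x|) f(|x|) dx = 8π a`. [cite: Fournais2020, App. A (A.5); LSSY2005, (2.5)] -/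
theorem lintegral_pot_mul_scatteringProfile (hw : Measurable w) (hM : ∀ r, w r ≤ ENNReal.ofReal M) (hM0 : 0 ≤ M)
    (hR : 0 < R) (hwR : ∀ s, R < s → w s = 0) :
    ∫⁻ x : Space, w ‖x‖ * ENNReal.ofReal (scatteringProfile w R x) =
      ENNReal.ofReal (8 * Real.pi) * scatteringLength w := by
  have hfc : Continuous (radialProfile w R) := (contDiff_radialProfile hw hM hM0).continuous
  have hFm : Measurable fun r => w r * ENNReal.ofReal (radialProfile w R r) :=
    hw.mul hfc.measurable.ennreal_ofReal
  have hpol := lintegral_comp_norm_eq_sphere hFm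
  rw [show (fun x : Space => w ‖x‖ * ENNReal.ofReal (scatteringProfile w R x)) =
      fun x : Space => w ‖x‖ * ENNReal.ofReal (radialProfile w R ‖x‖) from rfl, hpol]
  -- the radial integral
  have hrad : ∫⁻ r in Ioi 0, ENNReal.ofReal (r ^ 2) * (w r * ENNReal.ofReal (radialProfile w R r)) =
      ENNReal.ofReal (2 * odeScatteringLength w R) := by
    rw [lintegral_Ioi_eq_add hR.le]
    have htail : ∫⁻ r in Ioi R, ENNReal.ofReal (r ^ 2) * (w r * ENNReal.ofReal (radialProfile w R r)) = 0 := by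
      refine (setLIntegral_congr_fun measurableSet_Ioi fun r hr => ?_).trans lintegral_zero
      rw [hwR r hr, zero_mul, mul_zero]
    rw [htail, add_zero]
    have hint : IntegrableOn (fun s => (w s).toReal / 2 * (s ^ 2 * radialProfile w R s)) (Ioc 0 R) :=
      integrableOn_Ioc_pot_mul hw hM hM0 (by fun_prop) R
    have hint2 : IntegrableOn (fun s => 2 * ((w s).toReal / 2 * (s ^ 2 * radialProfile w R s))) (Ioc 0 R) :=
      hint.const_mul 2
    have heq : ∀ r ∈ Ioc 0 R, ENNReal.ofReal (r ^ 2) * (w r * ENNReal.ofReal (radialProfile w R r)) =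
        ENNReal.ofReal (2 * ((w r).toReal / 2 * (r ^ 2 * radialProfile w R r))) := by
      intro r _
      have hf0 := (radialProfile_pos hw hM hM0 R r).le
      conv_lhs => rw [← ofReal_toReal_pot hM r]
      rw [← ENNReal.ofReal_mul ENNReal.toReal_nonneg, ← ENNReal.ofReal_mul (sq_nonneg _)]
      congr 1; ring
    rw [setLIntegral_congr_fun measurableSet_Ioc heq, ← ofReal_integral_eq_lintegral_ofReal hint2, integral_const_mul]
    · congr 1
      rw [← integral_pot_sq_profile hw hM hM0 hR hwR]
      congr 1
      refine setIntegral_congr_fun measurableSet_Ioc fun s _ => ?_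
      ring
    · filter_upwards [ae_restrict_mem measurableSet_Ioc] with r hr
      have := (radialProfile_pos hw hM hM0 R r).le
      have : 0 ≤ (w r).toReal / 2 := div_nonneg ENNReal.toReal_nonneg zero_le_two
      have := hr.1.le
      positivity
  rw [hrad, scatteringLength_eq_ofReal_odeScatteringLength hw hM hM0 hR hwR, ← ENNReal.ofReal_mul (by positivity),
    ← ENNReal.ofReal_mul (by positivity)]
  congr 1; ring

end Identification


end Literature.MathematicalPhysics.QuantumManyBody.BoseGas

end
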